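import Literature.NumberTheory.Transcendental.KontsevichZagierGammaProofs
import HarnessLib

/-!
# `BetaLinearSector` (stmt-KontsevichZagierPeriods-3897), line `fermat-sector-transport` — stub `stub_piGammaMonomial`

The transcendence input of the LEVEL-3 rung (`a, b, a', b' ∈ ⅓ℤ`) of the crux `BetaLinearSector`
(route FermatIsogeny): on that sub-sector every Beta value is an algebraic multiple of one of
`1, π, Γ(1/3)³/π, π²/Γ(1/3)³`, and the classes are SEPARATED by the fact proved here: distinct
monomials `π^m Γ(1/3)^n` are never real-algebraic multiples of one another,
`π^m Γ(1/3)^n ≠ k · π^{m'} Γ(1/3)^{n'}` for `k ∈ ℚ̄ ∩ ℝ` and `(m, n) ≠ (m', n')`.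

Proof.  By Chudnovsky (1976) `π` and `Γ(1/3)` are algebraically independent over `ℚ`
(`Literature.NumberTheory.Transcendental.algebraicIndependent_real_pi_gamma_one_third`, proved in
the tree from Chudnovsky's theorem on the equianharmonic curve), hence — algebraic independence
persists to algebraic extensions of the base, `AlgebraicIndependent.algebraicClosure` — over the
relative algebraic closure `K = algebraicClosure ℚ ℝ` of `ℚ` in `ℝ`, which contains `k`.  An
identity `π^m Γ(1/3)^n = k · π^{m'} Γ(1/3)^{n'}` says that the two-variable polynomial
`X₀^m X₁^n − k · X₀^{m'} X₁^{n'} ∈ K[X₀, X₁]` vanishes at `(π, Γ(1/3))`; it is non-zero because its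
coefficient at the monomial `X₀^m X₁^n` is `1` (the two exponent vectors differ), contradicting the
algebraic independence over `K`.  The general statement for an arbitrary algebraically independent
real pair is `monomial_ne_algebraic_mul_monomial`.

References: G. V. Chudnovsky, *Contributions to the theory of transcendental numbers*, AMS Surveys 19
(1984), Ch. 7 §2, Corollary 2.3 and (2.12)–(2.13); M. Waldschmidt, *Elliptic functions and
transcendence* (2008), §5.2 Corollary 33; M. Kontsevich, D. Zagier, *Periods* (2001), §1.2.
-/

noncomputable section

namespace Summit.KontsevichZagierPeriods.FermatIsogeny.BetaLinearSector.Thirds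

open MvPolynomial
open Literature.NumberTheory.Transcendental

/-- **Distinct monomials in an algebraically independent real pair are not algebraic multiples of one
another.**  If `x, y : ℝ` are algebraically independent over `ℚ`, `k` is a real algebraic number and
`(m, n) ≠ (m', n')`, then `x^m y^n ≠ k · x^{m'} y^{n'}`: the pair stays algebraically independent over
the relative algebraic closure `K` of `ℚ` in `ℝ` (`AlgebraicIndependent.algebraicClosure`), and
`X₀^m X₁^n − k X₀^{m'} X₁^{n'}` is a non-zero polynomial over `K` (coefficient `1` at `X₀^m X₁^n`).
[folklore] -/
theorem monomial_ne_algebraic_mul_monomial {x y : ℝ} (h : AlgebraicIndependent ℚ ![x, y])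
    {k : ℝ} (hk : IsAlgebraic ℚ k) {m n m' n' : ℕ} (hne : m ≠ m' ∨ n ≠ n') :
    x ^ m * y ^ n ≠ k * (x ^ m' * y ^ n') := by
  intro heq
  have hK : AlgebraicIndependent (algebraicClosure ℚ ℝ) ![x, y] := h.algebraicClosure
  set k' : algebraicClosure ℚ ℝ := ⟨k, mem_algebraicClosure_iff.2 hk⟩ with hk'
  -- the two exponent vectors
  set d : Fin 2 →₀ ℕ := Finsupp.single 0 m + Finsupp.single 1 n with hd
  set d' : Fin 2 →₀ ℕ := Finsupp.single 0 m' + Finsupp.single 1 n' with hd'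
  have hdd : d' ≠ d := by
    intro hdd
    rcases hne with hm | hn
    · exact hm (by simpa [hd, hd'] using (DFunLike.congr_fun hdd 0).symm)
    · exact hn (by simpa [hd, hd'] using (DFunLike.congr_fun hdd 1).symm)
  -- the relation, as a polynomial over `K`
  set P : MvPolynomial (Fin 2) (algebraicClosure ℚ ℝ) :=
    X 0 ^ m * X 1 ^ n - C k' * (X 0 ^ m' * X 1 ^ n') with hP
  have heval : aeval ![x, y] P = 0 := by
    simp only [hP, map_sub, map_mul, map_pow, aeval_X, aeval_C, Matrix.cons_val_zero,
      Matrix.cons_val_one, Matrix.cons_val_fin_one, IntermediateField.algebraMap_apply, hk']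
    rw [heq, sub_self]
  have hcoeff : coeff d P = 1 := by
    simp only [hP, X_pow_eq_monomial, monomial_mul, C_mul_monomial, coeff_sub, coeff_monomial,
      mul_one, ← hd, ← hd', if_neg hdd, sub_zero, ite_true]
  have hP0 : P = 0 := hK.eq_zero_of_aeval_eq_zero P heval
  rw [hP0, coeff_zero] at hcoeff
  exact zero_ne_one hcoeff

/-- **Stub `stub_piGammaMonomial` — distinct monomials `π^m Γ(1/3)^n` are never algebraic multiples of
one another.**  For a real algebraic `k` and `(m, n) ≠ (m', n')`,
`π^m Γ(1/3)^n ≠ k · (π^{m'} Γ(1/3)^{n'})`.  Immediate from the algebraic independence of `π` and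
`Γ(1/3)` over `ℚ` (Chudnovsky 1976, `algebraicIndependent_real_pi_gamma_one_third`, proved in the
tree) via `monomial_ne_algebraic_mul_monomial`.  This is the class-separation input of the level-3
rung of `BetaLinearSector` (Beta values with parameters in `⅓ℤ` lie in
`ℚ̄·{1, π, Γ(1/3)³/π, π²/Γ(1/3)³}`).
[cite: Chudnovsky1984, Ch. 7 §2 Corollary 2.3 (p. 307) and (2.12)–(2.13) (p. 308)] -/
theorem stub_piGammaMonomial : ∀ (k : ℝ), IsAlgebraic ℚ k → ∀ (m n m' n' : ℕ), (m ≠ m' ∨ n ≠ n') → Real.pi ^ m * Real.Gamma (1/3) ^ n ≠ k * (Real.pi ^ m' * Real.Gamma (1/3) ^ n') :=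
  fun _k hk _m _n _m' _n' hne =>
    monomial_ne_algebraic_mul_monomial algebraicIndependent_real_pi_gamma_one_third hk hne

end Summit.KontsevichZagierPeriods.FermatIsogeny.BetaLinearSector.Thirds

end
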